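import Mathlib
import Literature.MathematicalPhysics.QuantumFieldTheory.Balaban1983to89.B9SectCDiff

/-!
# Bałaban, *Propagators for Lattice Gauge Theories II* (B6, CMP 96, 1984) — the domain change in (2.82),
# line 3, at the level of the 𝔅-block majorants of (2.51)–(2.55)

T. Bałaban, Commun. Math. Phys. **96** (1984) 223–250, bib key `Balaban1984PropagatorsII`; journal page =
PDF page + 222.

THE SENTENCE UNDER AUDIT (p. 238, before (2.85)): *"Similar inequalities hold for kernels of the other
operators forming R, for example the operator with G′(□̃)² − G′² is small and an estimate has the factor
e^{−δ₀M} because of the usual estimate of the type (1.12) [3] connected with a change of a domain. This estimate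
follows from the random walk representations (2.50) for the operators G′, G′(□̃)."*  The operator is the third
line of (2.82) (p. 237): *"− Σ_□ □Q′(G′(□̃)² − G′²)Q′*h_□C_□h_□"* — the difference of the squares of the
propagator localized to the enlarged cube □̃ and of the global one, cut on the left by the characteristic function
□ and on the right by h_□, i.e. at points whose distance to the region where the two operators differ is of the
order of M big blocks (□̃ is *"of the size 4M"* with □ *"in the middle"*, p. 235).

WHAT IS CERTIFIED HERE (cell GAPS G-B6-11 / C-b06g6-1 flag (i) / C-b06g7-1 flags (i), (iii)).  The sibling
`…B6DomainChange` certifies the (1.12)-mechanism for inverses in the uniform-gap class `B4Sect5Torus.Hyp56`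
((5.6) of [3]); that class does NOT contain the fine-lattice multiscale operators Δ′_a of B6 with (j, η)-uniform
constants (the ratio entry-bound/gap grows like L^{2k}; recorded in the header of `…B9SectCDiff`), so its §A does
not reach the operators of (2.82).  The sibling `…B9SectCDiff` (reader lineage r1) supplies the replacement at
the level of MATRICES: the smooth-cut identity `G₁·Jχ·G₂ = G₁Xχ − XχG₂` and the zone lemmas
`Shape.mul_of_zone` / `Shape.zone_sandwich`, and lists among what it does not do the scale weights, the
`HasMajorant` translation and the assembled expansion as one Lean theorem (left to the consumer).  This module is that consumer for the B6 term: it works with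
OPERATORS on the fine lattice (`Module.End ℝ (X → ℝ)`) and their 𝔅-BLOCK MAJORANTS
(`B6RandomWalk.HasMajorant`, the currency of (2.51)–(2.55), (2.64)–(2.67), in which the constants are M-, j-,
η-uniform), and proves:

* §1 (any ring) the CUT-INVERSE IDENTITIES for ONE local operator `D` (= Δ′_a), its global inverse `G` (= G′,
  `G·D = D·G = 1`) and a local inverse `Gw` (= G′(□̃)) which inverts `D` against a cutoff `χ` supported inside the
  window (`χ·D·Gw = χ`, `Gw·D·χ = χ` — `cutHyp_left/right` derive these from "`Gw` inverts the window operator `Dw`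
  on the window, `D` and `Dw` agree at supp χ"):  `χ·Gw = G·χ − G·[χ,D]·Gw` (`cut_localInverse`),
  `Gw·χ = χ·G + Gw·[χ,D]·G` (`localInverse_cut`), `[χ,D] := χD − Dχ`; and the CORE SQUARE IDENTITY
  (`core_sq_sub_sq`): for cuts `cL·χ = cL`, `χ·cR = cR`,
  `cL·(Gw² − G²)·cR = cL·( Gχ·E₂ + E₁·χG + E₁·E₂ − G·(1 − χ²)·G )·cR`,
  `E₁ := χGw − Gχ = −G[χ,D]Gw`, `E₂ := Gwχ − χG = Gw[χ,D]G` — every term has a factor localized where χ varies or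
  where χ² ≠ 1, i.e. in the ZONE outside the core {χ = 1}.
* §2 the 𝔅-majorant toolkit the translation needs and the siblings do not have in B6-generic form: `hasMajorant_neg
  /_sub`, right cut `hasMajorant_mulOp_right`, row-zone cut `hasMajorant_mulOp_zone`, and the WEIGHTED PRODUCT
  `hasMajorant_mul_weighted`: majorants `P(y)·F(y,y″)` and `P(y″)·H(y″,y′)` compose to
  `Λ·P(y)²·Σ_{y″} e^{κd(y,y″)}F(y,y″)H(y″,y′)` under the SCALE-TRANSFER hypothesis `e^{−κd(y,y″)}P(y″) ≤ ΛP(y)` (for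
  `P(y) = (Lʲη)²`, `y ∈ Λ_j`, this is (2.60): crossing a scale costs `RM` in `d` and a factor `L²` in `P`; cf.
  `…B9Ineq347.scaleTransfer_of_260`); the kernels `expK` (the standard factors `c·e^{−δd}`) and `zoneK`
  (`1_N(y)·θ·e^{−δd}`), the tilt `e^{κd}·expK(δ) = expK(δ − κ)`, `tilt_conv_le`, and the (1.12)-SHAPE of the
  convolution `expK ⋆ zoneK` (`shape_conv_zone`, = `B9SectCDiff.Shape.mul_of_zone` on 𝔅 with positions `id` and
  profile (2.61)).
* §3 the ASSEMBLED THEOREM `line3_core_majorant`: from (2.67)₁-type majorants `B₁P(y)e^{−δd(y,y′)}` of `G` and of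
  `Gw`, ZONE majorants `1_N(y)θe^{−δd(y,y′)}` of `[χ,D]·Gw` and `[χ,D]·G` (N ⊂ 𝔅 = the blocks where χ is not ≡ 1 or
  which see such a block through `D`; θ = the commutator's size, O(M⁻¹) for a cutoff of slope (M·scale)⁻¹ — the
  locality input, discharged by the consumer from (2.67)₂,₃ exactly as `hZ` of `B9SectCDiff.wa_core_of_cut`), a
  depth `β` on 𝔅 vanishing on N, the profile `K` of (2.61) and the scale transfer, the cut difference of squares
  `cL·(Gw·Gw − G·G)·cR` has the 𝔅-majorant
  `Λ·P(y)²·Ctot·e^{−((δ−κ)/6)(d(y,y′) + β(y) + β(y′))}` with the closed form `Ctot K B₁ θ (δ−κ)` (`Ctot`); and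
  the DEEP EVALUATION `line3_deep_majorant`: if the cuts live on blocks of depth `≥ M₀` the majorant is
  `Λ·P(y)²·Ctot·e^{−((δ−κ)/3)M₀}·e^{−((δ−κ)/6)d(y,y′)}` — the printed *"factor e^{−δ₀M}"* (two propagator legs each
  crossing the distance M₀ from the core to the zone) times the standard exponential factor, with the weight
  `(Lʲη)⁴` of G′² ((2.67)₁ squared, the `(Lʲη)^4` of (2.83)).
* §4 (v1.1) the BOOKKEEPING HYPOTHESES of §3 discharged from the DISPLAYED inequalities of Lemma 2.1 and the
  zone: (2.60) (`B6RandomWalk.Ineq260`, at an exponent α′) ⇒ the scale transfer `e^{−α′δ₀d(y,y″)}(L^{j″}η)² ≤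
  L²(Lʲη)²` under the located size condition `L²e^{−α′δ₀RM} ≤ 1`, i.e. RM ≥ 2 ln L/(α′δ₀)
  (`transfer_pow_of_ineq260`, `transfer_len_sq_of_ineq260`; logarithmic form `pow_mul_exp_neg_le_one`); (2.61)
  (`B6RandomWalk.Ineq261`, at an exponent α) ⇒ a `Profile` (`profileK`, `profile_of_ineq261`: the printed c₁(α) at
  rates ≥ αδ₀, the count |𝔅| below — uniformity exactly where (2.61) gives it); the depth to the zone
  `zoneDepth` (min_{n∈N} d(·,n)) is an `IsDepth` vanishing on N (`isDepth_zoneDepth`, `zoneDepth_eq_zero`,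
  `le_zoneDepth`); and the corollary `line3_deep_majorant_lemma21` = `line3_deep_majorant` with `P = (Lʲη)²`,
  `Λ = L²`, `κ = α′δ₀`, `β = zoneDepth`: its only hypotheses beyond (2.60), (2.61), (2.54) and the size condition are
  the four majorants (the analytic inputs) and the algebraic cut relations.

ROUTE: OURS (resolvent/commutator identity + majorant calculus), using only OUTPUTS of the random walk
representation — the (2.67)-type majorants of G′ and of G′(□̃) (p. 228: *"All the reasonings and the results of
this paper hold, with minor and obvious changes, for the operators G(Ω)"*, *"G(Ω) = (Δ_a↾_Ω)⁻¹ = (ΩΔ_aΩ)⁻¹"* — a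
restriction-type inverse, whence the hypotheses of `cutHyp_left/right`; p. 235: *"we take a second cube □̃ containing
□ in the middle and of the size 4M and we take an inverse of the operator (Q′G′(□̃)²Q′*)↾_□ instead of
(Q′G′²Q′*)↾_□"*; cell GAPS G-B6-02) — not the printed walk-by-walk
subtraction of the two expansions (2.50), whose bookkeeping either costs e^{O(δ₀M)} or the rate (cell GAPS
G-B9-19, `…B9Thm314`).  For B6's term the operators Q′, Q′* stand between the cuts and the propagators:
`□Q′ = Q′·(□∘y)` and `Q′*h_□ = (h_□∘y)·Q′*` for block-constant □ and the block map y(·) of p. 231, so the theorem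
is applied to `(□∘y)·(G′(□̃)² − G′²)·(h_□∘y)` on the fine lattice and composed with the majorants of Q′, Q′*
(`…B6RandomWalkHom.HasMajorantHom`) by the consumer.

SCOPE / FLAGS.  (i) Hypotheses, not certified here: the (2.67)₁-type majorants of G′ and G′(□̃) (Proposition
2.2 and its □̃-version), the zone majorants of the commutator products (locality of Δ′_a + (2.67)₂,₃ + the slope
of the cutoff), the pseudo-distance axioms of d (2.46)/(2.54); in §3 also the scale transfer, the profile and the
depth function as abstract hypotheses — §4 (v1.1) derives these three from the printed (2.60), (2.61)
(`B6RandomWalk.Ineq260/261`, i.e. Lemma 2.1 as displayed; its own status is the cell's record on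
`…B6Lemma21Repaired`, not asserted here) and from the zone distance.  (ii) RATES and
CONSTANTS: the print has the full rate δ₀ and *"the factor e^{−δ₀M}"*; the certificate has rate (δ − κ)/6 in the
shape and e^{−((δ−κ)/3)M₀} at depth M₀ (each product halves the rate, the zone step thirds it, the transfer costs
κ) — equality of rates is NOT claimed (cell DIVERGENCE D-b06.21).  (iii) Single cutoff χ with core {χ = 1} ⊇ supports of both
cuts; for the B6 term (cL = □, cR = h_□) take any χ of slope (M·scale)⁻¹ with □ ∪ supp h_□ ≺ χ, supported inside □̃
at distance ≥ range(Δ′_a) from □̃ᶜ — the theorem is stated for abstract cuts and does not fix this choice.  (iv) VALUE = kernel certificate of a located, undisplayed step of the paper under audit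
(the mechanism behind one sentence of p. 238), NOT summit progress; nothing here is citable for the disputed
steps of the programme.
-/

namespace Literature.MathematicalPhysics.QuantumFieldTheory.Balaban1983to89.B6DomainMajorant

open Finset Real Matrix
open B4Sect5Torus (IsPseudoDist)
open B6DomainChange
open B6RandomWalk (HasMajorant BlockSupp hasMajorant_mono hasMajorant_add hasMajorant_mul)
open B9Thm37Sum (mulOp mulOp_apply)

/-! ## §1  The cut local inverse against the global inverse (identities in any ring) -/

section Algebra

variable {A : Type*} [Ring A]

/-- `χ·D·Gw = χ` from: `Gw` is a right inverse of the window operator `Dw` on the window (`Dw·Gw = Pw`), `D` and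
`Dw` have the same rows at supp χ (`χ·D = χ·Dw`), supp χ ⊂ window (`χ·Pw = χ`). [folklore] -/
theorem cutHyp_left {D Dw Gw Pw χ : A} (hagree : χ * D = χ * Dw) (hinv : Dw * Gw = Pw) (hχP : χ * Pw = χ) :
    χ * D * Gw = χ := by
  rw [hagree, mul_assoc, hinv, hχP]

/-- `Gw·D·χ = χ` from: `Gw·Dw = Pw`, same columns at supp χ (`D·χ = Dw·χ`), `Pw·χ = χ`. [folklore] -/
theorem cutHyp_right {D Dw Gw Pw χ : A} (hagree : D * χ = Dw * χ) (hinv : Gw * Dw = Pw) (hPχ : Pw * χ = χ) :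
    Gw * D * χ = χ := by
  rw [mul_assoc, hagree, ← mul_assoc, hinv, hPχ]

/-- **The cut local inverse, I**: `χ·Gw = G·χ − G·[χ,D]·Gw` (`G·D = 1`, `χ·D·Gw = χ`) — the localized propagator
cut on the left is the global one cut on the right up to a term through the COMMUTATOR `[χ,D] = χD − Dχ`, which is
localized where χ varies (p. 238: *"An estimate of the terms with the commutator is even simpler and gives a
factor O(M⁻¹)."*; the `R = 0` case of `B9SectCDiff.core_identity` / `tdef_inv`, here for operators). [folklore] -/
theorem cut_localInverse {G D Gw χ : A} (hGD : G * D = 1) (hχ : χ * D * Gw = χ) :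
    χ * Gw = G * χ - G * (χ * D - D * χ) * Gw := by
  have h1 : G * (χ * D - D * χ) * Gw = G * χ - χ * Gw := by
    rw [mul_sub, sub_mul, mul_assoc G (χ * D) Gw, hχ, ← mul_assoc G D χ, hGD, one_mul]
  rw [h1]; abel

/-- **The cut local inverse, II** (mirror image): `Gw·χ = χ·G + Gw·[χ,D]·G` (`D·G = 1`, `Gw·D·χ = χ`). [folklore] -/
theorem localInverse_cut {G D Gw χ : A} (hDG : D * G = 1) (hχ : Gw * D * χ = χ) :
    Gw * χ = χ * G + Gw * (χ * D - D * χ) * G := by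
  have h1 : Gw * (χ * D - D * χ) * G = Gw * χ - χ * G := by
    rw [mul_sub, sub_mul, ← mul_assoc Gw χ D, mul_assoc (Gw * χ) D G, hDG, mul_one, ← mul_assoc Gw D χ, hχ]
  rw [h1]; abel

/-- the inner square identity (no hypotheses): with `E₁ = χGw − Gχ`, `E₂ = Gwχ − χG`,
`Gχ·E₂ + E₁·χG + E₁·E₂ − G(1 − χ²)G = χ·Gw·Gw·χ − G·G`. [folklore] -/
theorem sq_sub_sq_inner (G Gw χ : A) :
    G * χ * (Gw * χ - χ * G) + (χ * Gw - G * χ) * (χ * G) + (χ * Gw - G * χ) * (Gw * χ - χ * G)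
      - G * ((1 - χ * χ) * G) = χ * Gw * Gw * χ - G * G := by
  noncomm_ring

/-- **The core square identity**: for cuts living inside the core of χ (`cL·χ = cL`, `χ·cR = cR`),
`cL·(Gw² − G²)·cR = cL·( Gχ·E₂ + E₁·χG + E₁·E₂ − G·(1 − χ²)·G )·cR` — every term carries a factor localized in
the zone where χ varies (`E₁`, `E₂`, by `cut_localInverse` / `localInverse_cut`) or where `χ² ≠ 1`.  This is the
algebra behind *"the operator with G′(□̃)² − G′² is small … because of … a change of a domain"*.
[cite: Balaban1984PropagatorsII, (2.82) p.237 + p.238] -/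
theorem core_sq_sub_sq (G Gw χ : A) {cL cR : A} (hL : cL * χ = cL) (hR : χ * cR = cR) :
    cL * (Gw * Gw - G * G) * cR =
      cL * (G * χ * (Gw * χ - χ * G) + (χ * Gw - G * χ) * (χ * G) + (χ * Gw - G * χ) * (Gw * χ - χ * G)
        - G * ((1 - χ * χ) * G)) * cR := by
  rw [sq_sub_sq_inner]
  have h1 : cL * (χ * Gw * Gw * χ) * cR = cL * (Gw * Gw) * cR := by
    calc cL * (χ * Gw * Gw * χ) * cR = (cL * χ) * (Gw * Gw) * (χ * cR) := by noncomm_ring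
      _ = cL * (Gw * Gw) * cR := by rw [hL, hR]
  rw [mul_sub, sub_mul, mul_sub, sub_mul, h1]

end Algebra

/-! ## §2  𝔅-majorant toolkit: cuts, weights, kernels -/

section Majorants

variable {g : B6.Geometry} {X : Type}

/-- `−T` has the majorants of `T`. [folklore] -/
theorem hasMajorant_neg (blk : X → g.Site) {T : Module.End ℝ (X → ℝ)} {K : g.Site → g.Site → ℝ}
    (h : HasMajorant blk T K) : HasMajorant blk (-T) K := by
  intro y' μ B hμ x
  rw [LinearMap.neg_apply, Pi.neg_apply, abs_neg]
  exact h y' μ B hμ x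

/-- majorants of a difference add. [folklore] -/
theorem hasMajorant_sub (blk : X → g.Site) {T₁ T₂ : Module.End ℝ (X → ℝ)} {K₁ K₂ : g.Site → g.Site → ℝ}
    (h₁ : HasMajorant blk T₁ K₁) (h₂ : HasMajorant blk T₂ K₂) :
    HasMajorant blk (T₁ - T₂) (fun a b => K₁ a b + K₂ a b) := by
  rw [sub_eq_add_neg]
  exact hasMajorant_add blk h₁ (hasMajorant_neg blk h₂)

/-- a bounded multiplier on the right (|f| ≤ 1: the cutoff χ, the h_□ of (2.82)) keeps a majorant.
[cite: Balaban1984PropagatorsII, (2.51) p.232] -/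
theorem hasMajorant_mulOp_right (blk : X → g.Site) {T : Module.End ℝ (X → ℝ)} {K : g.Site → g.Site → ℝ}
    (hT : HasMajorant blk T K) (f : X → ℝ) (hf : ∀ x, |f x| ≤ 1) : HasMajorant blk (T * mulOp f) K := by
  intro y' μ B hμ x
  have hμ' : BlockSupp blk (mulOp f μ) y' B := by
    refine ⟨hμ.nonneg, fun x' hx' => ?_, fun x' hx' => ?_⟩
    · rw [mulOp_apply, abs_mul]
      calc |f x'| * |μ x'| ≤ 1 * B := mul_le_mul (hf x') (hμ.bound x' hx') (abs_nonneg _) zero_le_one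
        _ = B := one_mul B
    · rw [mulOp_apply, hμ.off x' hx', mul_zero]
  rw [Module.End.mul_apply]
  exact hT y' _ B hμ' x

variable [DecidableEq g.Site]

/-- **row-zone cut**: a multiplier `f`, |f| ≤ 1, vanishing on the blocks outside `N` (e.g. `1 − χ²` outside the
zone of χ) in front of `T` (majorant `K`) gives the majorant `1_N(y)·K(y,y′)`. [folklore] -/
theorem hasMajorant_mulOp_zone (blk : X → g.Site) {T : Module.End ℝ (X → ℝ)} {K : g.Site → g.Site → ℝ}
    (hT : HasMajorant blk T K) (f : X → ℝ) (hf : ∀ x, |f x| ≤ 1) (N : Finset g.Site)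
    (hf0 : ∀ x, blk x ∉ N → f x = 0) :
    HasMajorant blk (mulOp f * T) (fun a b => (if a ∈ N then (1 : ℝ) else 0) * K a b) := by
  intro y' μ B hμ x
  rw [Module.End.mul_apply, mulOp_apply, abs_mul]
  by_cases hx : blk x ∈ N
  · have e : (fun a b => (if a ∈ N then (1 : ℝ) else 0) * K a b) (blk x) y' = K (blk x) y' := by
      simp only [hx, if_true, one_mul]
    rw [e]
    calc |f x| * |T μ x| ≤ 1 * (K (blk x) y' * B) :=
          mul_le_mul (hf x) (hT y' μ B hμ x) (abs_nonneg _) zero_le_one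
      _ = K (blk x) y' * B := one_mul _
  · have e : (fun a b => (if a ∈ N then (1 : ℝ) else 0) * K a b) (blk x) y' = 0 := by
      simp only [hx, if_false, zero_mul]
    rw [e, hf0 x hx, abs_zero, zero_mul, zero_mul]

omit [DecidableEq g.Site] in
/-- **weighted product with scale transfer**: if `L` has the majorant `P(y)F(y,y″)` and `R` the majorant
`P(y″)H(y″,y′)` (`P, F, H ≥ 0`) and the weight obeys `e^{−κd(y,y″)}P(y″) ≤ ΛP(y)` (for `P = (Lʲη)²` on `Λ_j`: the
scale transfer of (2.60), a change of scale costs `RM` in `d`), then `L·R` has the majorant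
`Λ·P(y)²·Σ_{y″} e^{κd(y,y″)}F(y,y″)H(y″,y′)` — the weight of the inner propagator is moved to the outer point at the
price of the tilt `e^{κd}` of the first kernel. [cite: Balaban1984PropagatorsII, (2.52)-(2.55) p.232 + (2.60) p.233] -/
theorem hasMajorant_mul_weighted (blk : X → g.Site) {L R : Module.End ℝ (X → ℝ)} {P : g.Site → ℝ}
    {F H : g.Site → g.Site → ℝ} {κ Λ : ℝ}
    (hL : HasMajorant blk L (fun a c => P a * F a c)) (hR : HasMajorant blk R (fun c b => P c * H c b))
    (hP0 : ∀ a, 0 ≤ P a) (hF : ∀ a c, 0 ≤ F a c) (hH : ∀ c b, 0 ≤ H c b)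
    (hPΛ : ∀ a c, Real.exp (-(κ * g.dist a c)) * P c ≤ Λ * P a) :
    HasMajorant blk (L * R)
      (fun a b => Λ * P a ^ 2 * ∑ c, Real.exp (κ * g.dist a c) * F a c * H c b) := by
  have key : ∀ a b, ∑ c, P a * F a c * (P c * H c b) ≤
      Λ * P a ^ 2 * ∑ c, Real.exp (κ * g.dist a c) * F a c * H c b := by
    intro a b
    rw [Finset.mul_sum]
    refine Finset.sum_le_sum fun c _ => ?_
    have hPc : P c ≤ Λ * P a * Real.exp (κ * g.dist a c) := by
      have h2 : Real.exp (κ * g.dist a c) * (Real.exp (-(κ * g.dist a c)) * P c) ≤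
          Real.exp (κ * g.dist a c) * (Λ * P a) :=
        mul_le_mul_of_nonneg_left (hPΛ a c) (Real.exp_pos _).le
      rw [← mul_assoc, ← Real.exp_add, add_neg_cancel, Real.exp_zero, one_mul] at h2
      linarith
    have hnn : 0 ≤ P a * F a c * H c b := mul_nonneg (mul_nonneg (hP0 a) (hF a c)) (hH c b)
    calc P a * F a c * (P c * H c b) = (P a * F a c * H c b) * P c := by ring
      _ ≤ (P a * F a c * H c b) * (Λ * P a * Real.exp (κ * g.dist a c)) :=
          mul_le_mul_of_nonneg_left hPc hnn
      _ = Λ * P a ^ 2 * (Real.exp (κ * g.dist a c) * F a c * H c b) := by ring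
  exact hasMajorant_mono blk (hasMajorant_mul blk hL hR (fun c b => mul_nonneg (hP0 c) (hH c b))) key

omit [DecidableEq g.Site] in
/-- weighted product, inner factor unweighted: majorants `P(y)F(y,y″)` and `H(y″,y′) ≥ 0` compose to
`P(y)·Σ_{y″}F(y,y″)H(y″,y′)`. [cite: Balaban1984PropagatorsII, (2.52)-(2.55) p.232] -/
theorem hasMajorant_mul_rowWeight (blk : X → g.Site) {L R : Module.End ℝ (X → ℝ)} {P : g.Site → ℝ}
    {F H : g.Site → g.Site → ℝ}
    (hL : HasMajorant blk L (fun a c => P a * F a c)) (hR : HasMajorant blk R H) (hH : ∀ c b, 0 ≤ H c b) :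
    HasMajorant blk (L * R) (fun a b => P a * ∑ c, F a c * H c b) := by
  refine hasMajorant_mono blk (hasMajorant_mul blk hL hR hH) (fun a b => le_of_eq ?_)
  rw [Finset.mul_sum]
  exact Finset.sum_congr rfl fun c _ => by ring

/-! ### the kernels: "the usual factors" and the zone kernels, as matrices on 𝔅 -/

/-- the standard exponential factor: the kernel `c·e^{−δd(y,y′)}` on 𝔅 × 𝔅 (the shape of (2.67) without the
weight). [cite: Balaban1984PropagatorsII, (2.67) p.235] -/
noncomputable def expK (g : B6.Geometry) (c δ : ℝ) : Matrix g.Site g.Site ℝ :=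
  Matrix.of fun a b => c * Real.exp (-(δ * g.dist a b))

/-- the ZONE kernel `1_N(y)·θ·e^{−δd(y,y′)}`: rows living on the blocks of the cut zone `N`. OURS (typing).
[cite: Balaban1984PropagatorsII, p.238] -/
noncomputable def zoneK (g : B6.Geometry) [DecidableEq g.Site] (N : Finset g.Site) (θ δ : ℝ) :
    Matrix g.Site g.Site ℝ :=
  Matrix.of fun a b => (if a ∈ N then θ else 0) * Real.exp (-(δ * g.dist a b))

omit [DecidableEq g.Site] in
/-- entries of `expK`. [folklore] -/
@[simp] theorem expK_apply (c δ : ℝ) (a b : g.Site) :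
    expK g c δ a b = c * Real.exp (-(δ * g.dist a b)) := rfl

/-- entries of `zoneK`. [folklore] -/
@[simp] theorem zoneK_apply (N : Finset g.Site) (θ δ : ℝ) (a b : g.Site) :
    zoneK g N θ δ a b = (if a ∈ N then θ else 0) * Real.exp (-(δ * g.dist a b)) := rfl

omit [DecidableEq g.Site] in
/-- `expK ≥ 0` for `c ≥ 0`. [folklore] -/
theorem expK_nonneg {c : ℝ} (hc : 0 ≤ c) (δ : ℝ) (a b : g.Site) : 0 ≤ expK g c δ a b := by
  rw [expK_apply]; positivity

/-- the zone indicator `1_N·θ` is nonnegative. [folklore] -/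
theorem ind_nonneg (N : Finset g.Site) {θ : ℝ} (hθ : 0 ≤ θ) (a : g.Site) :
    0 ≤ (if a ∈ N then θ else 0) := by
  split_ifs
  · exact hθ
  · exact le_rfl

/-- the zone indicator `1_N·θ` is at most θ. [folklore] -/
theorem ind_le (N : Finset g.Site) {θ : ℝ} (hθ : 0 ≤ θ) (a : g.Site) :
    (if a ∈ N then θ else 0) ≤ θ := by
  split_ifs
  · exact le_rfl
  · exact hθ

/-- `zoneK ≥ 0` for `θ ≥ 0`. [folklore] -/
theorem zoneK_nonneg (N : Finset g.Site) {θ : ℝ} (hθ : 0 ≤ θ) (δ : ℝ) (a b : g.Site) :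
    0 ≤ zoneK g N θ δ a b := by
  rw [zoneK_apply]; exact mul_nonneg (ind_nonneg N hθ a) (Real.exp_pos _).le

/-- nonzero rows of `zoneK` lie in the zone. [folklore] -/
theorem zoneK_zone {N : Finset g.Site} {θ δ : ℝ} {a b : g.Site} (h : zoneK g N θ δ a b ≠ 0) : a ∈ N := by
  by_contra ha
  apply h
  rw [zoneK_apply, if_neg ha, zero_mul]

omit [DecidableEq g.Site] in
/-- `expK` is a decaying kernel in the sense of `B6DomainChange.Decay` (positions = the points of 𝔅). [folklore] -/
theorem decay_expK {c : ℝ} (hc : 0 ≤ c) (δ : ℝ) :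
    Decay g.dist (fun a : g.Site => a) (fun a : g.Site => a) c δ (expK g c δ) := by
  intro a b
  rw [abs_of_nonneg (expK_nonneg hc δ a b), expK_apply]

/-- `zoneK` decays with constant θ. [folklore] -/
theorem decay_zoneK (N : Finset g.Site) {θ : ℝ} (hθ : 0 ≤ θ) (δ : ℝ) :
    Decay g.dist (fun a : g.Site => a) (fun a : g.Site => a) θ δ (zoneK g N θ δ) := by
  intro a b
  rw [abs_of_nonneg (zoneK_nonneg N hθ δ a b), zoneK_apply]
  exact mul_le_mul_of_nonneg_right (ind_le N hθ a) (Real.exp_pos _).le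

omit [DecidableEq g.Site] in
/-- lowering the rate raises the kernel (d ≥ 0). [folklore] -/
theorem expK_antitone {c δ δ' : ℝ} (hc : 0 ≤ c) (hδ : δ' ≤ δ) {a b : g.Site} (hd : 0 ≤ g.dist a b) :
    expK g c δ a b ≤ expK g c δ' a b := by
  rw [expK_apply, expK_apply]
  exact mul_le_mul_of_nonneg_left (Real.exp_le_exp.2 (by nlinarith)) hc

/-- lowering the rate raises the zone kernel (d ≥ 0). [folklore] -/
theorem zoneK_antitone (N : Finset g.Site) {θ δ δ' : ℝ} (hθ : 0 ≤ θ) (hδ : δ' ≤ δ) {a b : g.Site}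
    (hd : 0 ≤ g.dist a b) : zoneK g N θ δ a b ≤ zoneK g N θ δ' a b := by
  rw [zoneK_apply, zoneK_apply]
  exact mul_le_mul_of_nonneg_left (Real.exp_le_exp.2 (by nlinarith)) (ind_nonneg N hθ a)

omit [DecidableEq g.Site] in
/-- **the tilt**: `e^{κd}·(c e^{−δd}) = c e^{−(δ−κ)d}`. [folklore] -/
theorem exp_mul_expK (κ c δ : ℝ) (a b : g.Site) :
    Real.exp (κ * g.dist a b) * expK g c δ a b = expK g c (δ - κ) a b := by
  rw [expK_apply, expK_apply, mul_left_comm, ← Real.exp_add]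
  congr 2; ring

/-- the tilt of the zone kernel: `e^{κd}·zoneK(δ) = zoneK(δ − κ)`. [folklore] -/
theorem exp_mul_zoneK (N : Finset g.Site) (κ θ δ : ℝ) (a b : g.Site) :
    Real.exp (κ * g.dist a b) * zoneK g N θ δ a b = zoneK g N θ (δ - κ) a b := by
  rw [zoneK_apply, zoneK_apply, mul_left_comm, ← Real.exp_add]
  congr 2; ring

omit [DecidableEq g.Site] in
/-- entries of a product of two entrywise nonnegative kernels are nonnegative. [folklore] -/
theorem conv_nonneg {U V : Matrix g.Site g.Site ℝ} (hU : ∀ a b, 0 ≤ U a b) (hV : ∀ a b, 0 ≤ V a b)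
    (a b : g.Site) : 0 ≤ (U * V) a b := by
  rw [Matrix.mul_apply]
  exact Finset.sum_nonneg fun c _ => mul_nonneg (hU a c) (hV c b)

omit [DecidableEq g.Site] in
/-- products of nonnegative kernels are monotone in both factors. [folklore] -/
theorem conv_mono {U V U' V' : Matrix g.Site g.Site ℝ} (hU : ∀ a b, 0 ≤ U a b) (hV : ∀ a b, 0 ≤ V a b)
    (hUU : ∀ a b, U a b ≤ U' a b) (hVV : ∀ a b, V a b ≤ V' a b) (a b : g.Site) :
    (U * V) a b ≤ (U' * V') a b := by
  rw [Matrix.mul_apply, Matrix.mul_apply]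
  exact Finset.sum_le_sum fun c _ => mul_le_mul (hUU a c) (hVV c b) (hV c b) ((hU a c).trans (hUU a c))

end Majorants

section Conv

variable {g : B6.Geometry} [DecidableEq g.Site]

/-- **tilting a zone convolution**: `e^{κd(y,y′)}·(expK(δ) ⋆ zoneK(δ))(y,y′) ≤ (expK(δ−κ) ⋆ zoneK(δ−κ))(y,y′)` —
the tilt is distributed over the two legs by the triangle inequality (2.54). [cite: Balaban1984PropagatorsII, (2.54) p.233] -/
theorem tilt_conv_le (hρ : IsPseudoDist g.dist) (N : Finset g.Site) {κ B₁ θ : ℝ} (hκ : 0 ≤ κ)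
    (hB₁ : 0 ≤ B₁) (hθ : 0 ≤ θ) (δ : ℝ) (a b : g.Site) :
    Real.exp (κ * g.dist a b) * (expK g B₁ δ * zoneK g N θ δ) a b ≤
      (expK g B₁ (δ - κ) * zoneK g N θ (δ - κ)) a b := by
  rw [Matrix.mul_apply, Matrix.mul_apply, Finset.mul_sum]
  refine Finset.sum_le_sum fun c _ => ?_
  have h1 : κ * g.dist a b ≤ κ * g.dist a c + κ * g.dist c b := by
    rw [← mul_add]; exact mul_le_mul_of_nonneg_left (hρ.triangle a c b) hκ
  have htri : Real.exp (κ * g.dist a b) ≤ Real.exp (κ * g.dist a c) * Real.exp (κ * g.dist c b) := by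
    rw [← Real.exp_add]; exact Real.exp_le_exp.2 h1
  have hnn : 0 ≤ expK g B₁ δ a c * zoneK g N θ δ c b :=
    mul_nonneg (expK_nonneg hB₁ δ a c) (zoneK_nonneg N hθ δ c b)
  calc Real.exp (κ * g.dist a b) * (expK g B₁ δ a c * zoneK g N θ δ c b)
      ≤ (Real.exp (κ * g.dist a c) * Real.exp (κ * g.dist c b)) * (expK g B₁ δ a c * zoneK g N θ δ c b) :=
        mul_le_mul_of_nonneg_right htri hnn
    _ = (Real.exp (κ * g.dist a c) * expK g B₁ δ a c) * (Real.exp (κ * g.dist c b) * zoneK g N θ δ c b) := by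
        ring
    _ = expK g B₁ (δ - κ) a c * zoneK g N θ (δ - κ) c b := by rw [exp_mul_expK, exp_mul_zoneK]

/-- **the (1.12)-shape of a zone convolution**: `(expK(B₁,δ₁) ⋆ zoneK(N,θ,δ₁))(y,y′)` — a propagator leg into the
zone followed by a zone-born leg — has the shape `(B₁θK(δ₁/3), δ₁/3)` with the depth (distance to the zone) of
BOTH end points: `B9SectCDiff.Shape.mul_of_zone` on 𝔅 with positions `id` and the profile (2.61).
[cite: Balaban1984PropagatorsII, (2.61) p.234 + p.238] -/
theorem shape_conv_zone (hρ : IsPseudoDist g.dist) {β : g.Site → ℝ} (hβ : IsDepth g.dist β) {K : ℝ → ℝ}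
    (hPr : Profile g.dist (fun a : g.Site => a) K) (N : Finset g.Site) (hN : ∀ a ∈ N, β a = 0)
    {B₁ θ δ₁ : ℝ} (hδ₁ : 0 < δ₁) (hB₁ : 0 ≤ B₁) (hθ : 0 ≤ θ) :
    Shape g.dist β (fun a : g.Site => a) (fun a : g.Site => a) (B₁ * θ * K (δ₁ / 3)) (δ₁ / 3)
      (expK g B₁ δ₁ * zoneK g N θ δ₁) :=
  B9SectCDiff.Shape.mul_of_zone hρ hβ hPr hδ₁ hB₁ hθ (decay_expK hB₁ δ₁) (decay_zoneK N hθ δ₁)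
    (fun _ s _ h => hN s (zoneK_zone (right_ne_zero_of_mul h)))

end Conv

/-! ## §3  The assembled theorem: (2.82), line 3, at the 𝔅-majorant level -/

section Line3

variable {g : B6.Geometry} [DecidableEq g.Site] {X : Type}

/-- `ε₁ = B₁θK(δ₁/3)`: the shape constant of one commutator term `G[χ,D]Gw`, `Gw[χ,D]G` (`shape_conv_zone`). OURS.
[cite: Balaban1984PropagatorsII, p.238] -/
noncomputable def eps1 (K : ℝ → ℝ) (B₁ θ δ₁ : ℝ) : ℝ := B₁ * θ * K (δ₁ / 3)

/-- the closed-form constant of `line3_core_majorant`: the four terms of `core_sq_sub_sq`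
(`Gχ·E₂`, `E₁·χG`, `E₁·E₂`, `G(1 − χ²)G`). OURS. [cite: Balaban1984PropagatorsII, p.238] -/
noncomputable def Ctot (K : ℝ → ℝ) (B₁ θ δ₁ : ℝ) : ℝ :=
  B₁ * eps1 K B₁ θ δ₁ * K (δ₁ / 3 / 2) + eps1 K B₁ θ δ₁ * B₁ * K (δ₁ / 3 / 2)
    + eps1 K B₁ θ δ₁ * eps1 K B₁ θ δ₁ * K (δ₁ / 3 / 2) + B₁ * B₁ * K (δ₁ / 3)

omit [DecidableEq g.Site] in
/-- `ε₁ ≥ 0`. [folklore] -/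
theorem eps1_nonneg {K : ℝ → ℝ} (hK : ∀ a, 0 < a → 0 ≤ K a) {B₁ θ δ₁ : ℝ} (hB₁ : 0 ≤ B₁) (hθ : 0 ≤ θ)
    (hδ₁ : 0 < δ₁) : 0 ≤ eps1 K B₁ θ δ₁ := by
  unfold eps1
  exact mul_nonneg (mul_nonneg hB₁ hθ) (hK _ (by positivity))

omit [DecidableEq g.Site] in
/-- `Ctot ≥ 0`. [folklore] -/
theorem Ctot_nonneg {K : ℝ → ℝ} (hK : ∀ a, 0 < a → 0 ≤ K a) {B₁ θ δ₁ : ℝ} (hB₁ : 0 ≤ B₁) (hθ : 0 ≤ θ)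
    (hδ₁ : 0 < δ₁) : 0 ≤ Ctot K B₁ θ δ₁ := by
  have h1 := eps1_nonneg hK hB₁ hθ hδ₁
  have h2 := hK (δ₁ / 3 / 2) (by positivity)
  have h3 := hK (δ₁ / 3) (by positivity)
  unfold Ctot
  positivity

/-- **(2.82), line 3 — the difference of squares cut to the core has the domain-change majorant.**
Data on the fine lattice `X` with block map `blk : X → 𝔅`: a local operator `D` (Δ′_a), its global inverse `G`
(G′: `GD = DG = 1`), a local inverse `Gw` (G′(□̃): `χ·D·Gw = χ`, `Gw·D·χ = χ` for the cutoff χ, cf.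
`cutHyp_left/right`), a cutoff `χ` (|χ| ≤ 1) equal to 1 on every block outside the ZONE `N ⊂ 𝔅`, cuts `cL`, `cR`
(|·| ≤ 1) living in the core (`cL·χ = cL`, `χ·cR = cR`: the printed □ and h_□); majorants of the printed shape
(2.67)₁ for `G` and `Gw` (`B₁P(y)e^{−δd}`, `P(y) = (Lʲη)²` on `Λ_j`), zone majorants `1_N(y)θe^{−δd}` for the
commutator products `[χ,D]Gw`, `[χ,D]G` (θ = the commutator's size — O(M⁻¹) for a cutoff of slope (M·scale)⁻¹),
a depth `β` (1-Lipschitz for d, vanishing on N), the profile `K` of (2.61), the scale transfer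
`e^{−κd(y,y″)}P(y″) ≤ ΛP(y)` ((2.60)), `0 ≤ κ < δ`.  Then
`cL·(Gw·Gw − G·G)·cR` has the 𝔅-majorant `Λ·P(y)²·Ctot·e^{−((δ−κ)/6)(d(y,y′) + β(y) + β(y′))}` — the (1.12)-shape
*"connected with a change of a domain"* with the weight `(Lʲη)⁴` of G′².  Mechanism: `core_sq_sub_sq` +
`cut_localInverse` / `localInverse_cut` (every term passes through the zone), `hasMajorant_mul_weighted` (scale
transfer), `shape_conv_zone` (= `B9SectCDiff.Shape.mul_of_zone`) and `B6DomainChange.Shape.mul_left/right`.  Rates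
degrade δ ↦ (δ−κ)/6 (cell DIVERGENCE D-b06.21); ROUTE ours (module docstring).
[cite: Balaban1984PropagatorsII, p.238 before (2.85) + (2.82) p.237 + (2.67) p.235] -/
theorem line3_core_majorant (blk : X → g.Site) (hρ : IsPseudoDist g.dist) {β : g.Site → ℝ}
    (hβ : IsDepth g.dist β) {K : ℝ → ℝ} (hK : ∀ a, 0 < a → 0 ≤ K a)
    (hPr : Profile g.dist (fun a : g.Site => a) K) (N : Finset g.Site) (hN : ∀ a ∈ N, β a = 0)
    {P : g.Site → ℝ} (hP0 : ∀ a, 0 ≤ P a) {κ Λ : ℝ} (hκ : 0 ≤ κ) (hΛ : 0 ≤ Λ)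
    (hPΛ : ∀ a c, Real.exp (-(κ * g.dist a c)) * P c ≤ Λ * P a)
    {δ B₁ θ : ℝ} (hκδ : κ < δ) (hB₁ : 0 ≤ B₁) (hθ : 0 ≤ θ)
    {G D Gw : Module.End ℝ (X → ℝ)} {χ cL cR : X → ℝ}
    (hχ1 : ∀ x, |χ x| ≤ 1) (hcL1 : ∀ x, |cL x| ≤ 1) (hcR1 : ∀ x, |cR x| ≤ 1)
    (hcLχ : ∀ x, cL x * χ x = cL x) (hcRχ : ∀ x, χ x * cR x = cR x)
    (hχN : ∀ x, blk x ∉ N → χ x = 1)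
    (hGD : G * D = 1) (hDG : D * G = 1)
    (hχGw : mulOp χ * D * Gw = mulOp χ) (hGwχ : Gw * D * mulOp χ = mulOp χ)
    (hG : HasMajorant blk G (fun a b => B₁ * P a * Real.exp (-(δ * g.dist a b))))
    (hGw : HasMajorant blk Gw (fun a b => B₁ * P a * Real.exp (-(δ * g.dist a b))))
    (hKGw : HasMajorant blk ((mulOp χ * D - D * mulOp χ) * Gw)
      (fun a b => (if a ∈ N then θ else 0) * Real.exp (-(δ * g.dist a b))))
    (hKG : HasMajorant blk ((mulOp χ * D - D * mulOp χ) * G)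
      (fun a b => (if a ∈ N then θ else 0) * Real.exp (-(δ * g.dist a b)))) :
    HasMajorant blk (mulOp cL * (Gw * Gw - G * G) * mulOp cR)
      (fun a b => Λ * P a ^ 2 * Ctot K B₁ θ (δ - κ) *
        Real.exp (-((δ - κ) / 3 / 2 * (g.dist a b + β a + β b)))) := by
  -- rates and signs
  have hδ₁ : 0 < δ - κ := by linarith
  have hr : 0 < (δ - κ) / 3 := by positivity
  have hrδ : (δ - κ) / 3 ≤ δ := by linarith
  have hrδ₁ : (δ - κ) / 3 ≤ δ - κ := by linarith
  have hδ₁δ : δ - κ ≤ δ := by linarith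
  have hε₁ : 0 ≤ eps1 K B₁ θ (δ - κ) := eps1_nonneg hK hB₁ hθ hδ₁
  have hKr : 0 ≤ K ((δ - κ) / 3) := hK _ hr
  have hdnn : ∀ a b : g.Site, 0 ≤ g.dist a b := hρ.nonneg
  have hS0 : ∀ a b : g.Site, 0 ≤ g.dist a b + β a + β b :=
    fun a b => add_nonneg (add_nonneg (hdnn a b) (hβ.nonneg a)) (hβ.nonneg b)
  -- the kernels F = expK(δ) ⋆ zoneK(δ) (majorant of the commutator terms) and Z = the same at rate δ − κ
  have hF0 : ∀ a b, 0 ≤ (expK g B₁ δ * zoneK g N θ δ) a b :=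
    conv_nonneg (expK_nonneg hB₁ δ) (zoneK_nonneg N hθ δ)
  have hZ0 : ∀ a b, 0 ≤ (expK g B₁ (δ - κ) * zoneK g N θ (δ - κ)) a b :=
    conv_nonneg (expK_nonneg hB₁ _) (zoneK_nonneg N hθ _)
  have hFZ : ∀ a b, (expK g B₁ δ * zoneK g N θ δ) a b ≤
      (expK g B₁ (δ - κ) * zoneK g N θ (δ - κ)) a b :=
    conv_mono (expK_nonneg hB₁ δ) (zoneK_nonneg N hθ δ)
      (fun a b => expK_antitone hB₁ hδ₁δ (hdnn a b)) (fun a b => zoneK_antitone N hθ hδ₁δ (hdnn a b))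
  have hFt : ∀ a b, Real.exp (κ * g.dist a b) * (expK g B₁ δ * zoneK g N θ δ) a b ≤
      (expK g B₁ (δ - κ) * zoneK g N θ (δ - κ)) a b := tilt_conv_le hρ N hκ hB₁ hθ δ
  have hZs : Shape g.dist β (fun a : g.Site => a) (fun a : g.Site => a) (eps1 K B₁ θ (δ - κ))
      ((δ - κ) / 3) (expK g B₁ (δ - κ) * zoneK g N θ (δ - κ)) :=
    shape_conv_zone hρ hβ hPr N hN hδ₁ hB₁ hθ
  have hZd : Decay g.dist (fun a : g.Site => a) (fun a : g.Site => a) (eps1 K B₁ θ (δ - κ))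
      ((δ - κ) / 3) (expK g B₁ (δ - κ) * zoneK g N θ (δ - κ)) := hZs.toDecay hβ hε₁ hr.le
  have hZm0 : ∀ a b : g.Site, 0 ≤ (if a ∈ N then θ else 0) * Real.exp (-(δ * g.dist a b)) :=
    fun a b => mul_nonneg (ind_nonneg N hθ a) (Real.exp_pos _).le
  -- the propagators with the weight pulled out
  have hGF : HasMajorant blk G (fun a c => P a * expK g B₁ δ a c) :=
    hasMajorant_mono blk hG (fun a c => le_of_eq (by rw [expK_apply]; ring))
  have hGwF : HasMajorant blk Gw (fun a c => P a * expK g B₁ δ a c) :=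
    hasMajorant_mono blk hGw (fun a c => le_of_eq (by rw [expK_apply]; ring))
  have sumF : ∀ a b : g.Site,
      ∑ c, expK g B₁ δ a c * ((if c ∈ N then θ else 0) * Real.exp (-(δ * g.dist c b))) =
        (expK g B₁ δ * zoneK g N θ δ) a b := by
    intro a b
    rw [Matrix.mul_apply]
    rfl
  -- E₁ = χGw − Gχ = −G[χ,D]Gw and E₂ = Gwχ − χG = Gw[χ,D]G, with their majorants
  have idE₁ : mulOp χ * Gw - G * mulOp χ = -(G * ((mulOp χ * D - D * mulOp χ) * Gw)) := by
    rw [cut_localInverse hGD hχGw, mul_assoc]; abel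
  have idE₂ : Gw * mulOp χ - mulOp χ * G = Gw * ((mulOp χ * D - D * mulOp χ) * G) := by
    rw [localInverse_cut hDG hGwχ, mul_assoc]; abel
  have hE₁ : HasMajorant blk (mulOp χ * Gw - G * mulOp χ)
      (fun a b => P a * (expK g B₁ δ * zoneK g N θ δ) a b) := by
    rw [idE₁]
    exact hasMajorant_neg blk (hasMajorant_mono blk (hasMajorant_mul_rowWeight blk hGF hKGw hZm0)
      (fun a b => le_of_eq (by rw [sumF])))
  have hE₂ : HasMajorant blk (Gw * mulOp χ - mulOp χ * G)
      (fun a b => P a * (expK g B₁ δ * zoneK g N θ δ) a b) := by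
    rw [idE₂]
    exact hasMajorant_mono blk (hasMajorant_mul_rowWeight blk hGwF hKG hZm0)
      (fun a b => le_of_eq (by rw [sumF]))
  have hE₂Z : HasMajorant blk (Gw * mulOp χ - mulOp χ * G)
      (fun c b => P c * (expK g B₁ (δ - κ) * zoneK g N θ (δ - κ)) c b) :=
    hasMajorant_mono blk hE₂ (fun c b => mul_le_mul_of_nonneg_left (hFZ c b) (hP0 c))
  -- term A = Gχ·E₂
  have hGχ : HasMajorant blk (G * mulOp χ) (fun a c => P a * expK g B₁ δ a c) :=
    hasMajorant_mulOp_right blk hGF χ hχ1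
  have hTA : HasMajorant blk (G * mulOp χ * (Gw * mulOp χ - mulOp χ * G))
      (fun a b => Λ * P a ^ 2 * (B₁ * eps1 K B₁ θ (δ - κ) * K ((δ - κ) / 3 / 2) *
        Real.exp (-((δ - κ) / 3 / 2 * (g.dist a b + β a + β b))))) := by
    have h1 := hasMajorant_mul_weighted blk hGχ hE₂Z hP0 (expK_nonneg hB₁ δ) hZ0 hPΛ
    refine hasMajorant_mono blk h1 (fun a b => mul_le_mul_of_nonneg_left ?_ (by positivity))
    have h2 : ∑ c, Real.exp (κ * g.dist a c) * expK g B₁ δ a c *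
        (expK g B₁ (δ - κ) * zoneK g N θ (δ - κ)) c b ≤
        (expK g B₁ ((δ - κ) / 3) * (expK g B₁ (δ - κ) * zoneK g N θ (δ - κ))) a b := by
      rw [Matrix.mul_apply (M := expK g B₁ ((δ - κ) / 3))]
      refine Finset.sum_le_sum fun c _ => mul_le_mul_of_nonneg_right ?_ (hZ0 c b)
      rw [exp_mul_expK]
      exact expK_antitone hB₁ hrδ₁ (hdnn a c)
    have h3 := B6DomainChange.Shape.mul_left hρ hβ hPr hr hε₁ hB₁ (decay_expK hB₁ ((δ - κ) / 3)) hZs a b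
    exact h2.trans ((le_abs_self _).trans h3)
  -- term B = E₁·χG
  have hχG : HasMajorant blk (mulOp χ * G) (fun c b => P c * expK g B₁ ((δ - κ) / 3) c b) := by
    refine hasMajorant_mono blk (B9Eq395Small.hasMajorant_mulOp_left blk hG χ hχ1) (fun c b => ?_)
    calc B₁ * P c * Real.exp (-(δ * g.dist c b)) = P c * expK g B₁ δ c b := by rw [expK_apply]; ring
      _ ≤ P c * expK g B₁ ((δ - κ) / 3) c b :=
          mul_le_mul_of_nonneg_left (expK_antitone hB₁ hrδ (hdnn c b)) (hP0 c)
  have hTB : HasMajorant blk ((mulOp χ * Gw - G * mulOp χ) * (mulOp χ * G))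
      (fun a b => Λ * P a ^ 2 * (eps1 K B₁ θ (δ - κ) * B₁ * K ((δ - κ) / 3 / 2) *
        Real.exp (-((δ - κ) / 3 / 2 * (g.dist a b + β a + β b))))) := by
    have h1 := hasMajorant_mul_weighted blk hE₁ hχG hP0 hF0 (expK_nonneg hB₁ _) hPΛ
    refine hasMajorant_mono blk h1 (fun a b => mul_le_mul_of_nonneg_left ?_ (by positivity))
    have h2 : ∑ c, Real.exp (κ * g.dist a c) * (expK g B₁ δ * zoneK g N θ δ) a c *
        expK g B₁ ((δ - κ) / 3) c b ≤
        ((expK g B₁ (δ - κ) * zoneK g N θ (δ - κ)) * expK g B₁ ((δ - κ) / 3)) a b := by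
      rw [Matrix.mul_apply (M := expK g B₁ (δ - κ) * zoneK g N θ (δ - κ))
        (N := expK g B₁ ((δ - κ) / 3))]
      exact Finset.sum_le_sum fun c _ => mul_le_mul_of_nonneg_right (hFt a c) (expK_nonneg hB₁ _ c b)
    have h3 := B6DomainChange.Shape.mul_right hρ hβ hPr hr hε₁ hB₁ hZs
      (decay_expK hB₁ ((δ - κ) / 3)) a b
    exact h2.trans ((le_abs_self _).trans h3)
  -- term C = E₁·E₂
  have hTC : HasMajorant blk ((mulOp χ * Gw - G * mulOp χ) * (Gw * mulOp χ - mulOp χ * G))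
      (fun a b => Λ * P a ^ 2 * (eps1 K B₁ θ (δ - κ) * eps1 K B₁ θ (δ - κ) * K ((δ - κ) / 3 / 2) *
        Real.exp (-((δ - κ) / 3 / 2 * (g.dist a b + β a + β b))))) := by
    have h1 := hasMajorant_mul_weighted blk hE₁ hE₂Z hP0 hF0 hZ0 hPΛ
    refine hasMajorant_mono blk h1 (fun a b => mul_le_mul_of_nonneg_left ?_ (by positivity))
    have h2 : ∑ c, Real.exp (κ * g.dist a c) * (expK g B₁ δ * zoneK g N θ δ) a c *
        (expK g B₁ (δ - κ) * zoneK g N θ (δ - κ)) c b ≤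
        ((expK g B₁ (δ - κ) * zoneK g N θ (δ - κ)) * (expK g B₁ (δ - κ) * zoneK g N θ (δ - κ))) a b := by
      rw [Matrix.mul_apply (M := expK g B₁ (δ - κ) * zoneK g N θ (δ - κ))
        (N := expK g B₁ (δ - κ) * zoneK g N θ (δ - κ))]
      exact Finset.sum_le_sum fun c _ => mul_le_mul_of_nonneg_right (hFt a c) (hZ0 c b)
    have h3 := B6DomainChange.Shape.mul_right hρ hβ hPr hr hε₁ hε₁ hZs hZd a b
    exact h2.trans ((le_abs_self _).trans h3)
  -- term D = G(1 − χ²)G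
  have hf1 : ∀ x, |1 - χ x * χ x| ≤ 1 := by
    intro x
    have h := hχ1 x
    have hsq : χ x * χ x ≤ 1 := by
      calc χ x * χ x = |χ x| * |χ x| := (abs_mul_abs_self (χ x)).symm
        _ ≤ 1 * 1 := mul_le_mul h h (abs_nonneg _) zero_le_one
        _ = 1 := one_mul 1
    have h0 : 0 ≤ χ x * χ x := mul_self_nonneg (χ x)
    rw [abs_le]
    constructor <;> linarith
  have hf0 : ∀ x, blk x ∉ N → 1 - χ x * χ x = 0 := fun x hx => by rw [hχN x hx]; ring
  have hfG : HasMajorant blk (mulOp (fun x => 1 - χ x * χ x) * G)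
      (fun c b => P c * zoneK g N B₁ (δ - κ) c b) := by
    refine hasMajorant_mono blk (hasMajorant_mulOp_zone blk hG (fun x => 1 - χ x * χ x) hf1 N hf0)
      (fun c b => ?_)
    rw [zoneK_apply]
    by_cases hc : c ∈ N
    · rw [if_pos hc, if_pos hc, one_mul]
      calc B₁ * P c * Real.exp (-(δ * g.dist c b)) = P c * (B₁ * Real.exp (-(δ * g.dist c b))) := by ring
        _ ≤ P c * (B₁ * Real.exp (-((δ - κ) * g.dist c b))) :=
            mul_le_mul_of_nonneg_left (mul_le_mul_of_nonneg_left
              (Real.exp_le_exp.2 (by nlinarith [hdnn c b])) hB₁) (hP0 c)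
    · rw [if_neg hc, if_neg hc, zero_mul, zero_mul, mul_zero]
  have hTD : HasMajorant blk (G * (mulOp (fun x => 1 - χ x * χ x) * G))
      (fun a b => Λ * P a ^ 2 * (B₁ * B₁ * K ((δ - κ) / 3) *
        Real.exp (-((δ - κ) / 3 / 2 * (g.dist a b + β a + β b))))) := by
    have h1 := hasMajorant_mul_weighted blk hGF hfG hP0 (expK_nonneg hB₁ δ) (zoneK_nonneg N hB₁ _) hPΛ
    refine hasMajorant_mono blk h1 (fun a b => mul_le_mul_of_nonneg_left ?_ (by positivity))
    have h2 : ∑ c, Real.exp (κ * g.dist a c) * expK g B₁ δ a c * zoneK g N B₁ (δ - κ) c b =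
        (expK g B₁ (δ - κ) * zoneK g N B₁ (δ - κ)) a b := by
      rw [Matrix.mul_apply (M := expK g B₁ (δ - κ)) (N := zoneK g N B₁ (δ - κ))]
      exact Finset.sum_congr rfl fun c _ => by rw [exp_mul_expK]
    have h3 := shape_conv_zone hρ hβ hPr N hN hδ₁ hB₁ hB₁ a b
    have h4 : B₁ * B₁ * K ((δ - κ) / 3) * Real.exp (-((δ - κ) / 3 * (g.dist a b + β a + β b))) ≤
        B₁ * B₁ * K ((δ - κ) / 3) * Real.exp (-((δ - κ) / 3 / 2 * (g.dist a b + β a + β b))) :=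
      mul_le_mul_of_nonneg_left (Real.exp_le_exp.2 (by nlinarith [hS0 a b])) (by positivity)
    exact (le_of_eq h2).trans ((le_abs_self _).trans (h3.trans h4))
  -- assembly
  have hsum := hasMajorant_sub blk (hasMajorant_add blk (hasMajorant_add blk hTA hTB) hTC) hTD
  have hcut := hasMajorant_mulOp_right blk (B9Eq395Small.hasMajorant_mulOp_left blk hsum cL hcL1) cR hcR1
  have hcLχ' : mulOp cL * mulOp χ = mulOp cL := by
    rw [B9Eq395Small.mulOp_mul_mulOp]; congr 1; funext x; exact hcLχ x
  have hχcR' : mulOp χ * mulOp cR = mulOp cR := by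
    rw [B9Eq395Small.mulOp_mul_mulOp]; congr 1; funext x; exact hcRχ x
  have hone : (1 : Module.End ℝ (X → ℝ)) - mulOp χ * mulOp χ = mulOp (fun x => 1 - χ x * χ x) := by
    apply LinearMap.ext
    intro μ
    funext x
    simp only [LinearMap.sub_apply, Pi.sub_apply, Module.End.one_apply, Module.End.mul_apply, mulOp_apply]
    ring
  have hop : mulOp cL * (Gw * Gw - G * G) * mulOp cR =
      mulOp cL * (G * mulOp χ * (Gw * mulOp χ - mulOp χ * G)
        + (mulOp χ * Gw - G * mulOp χ) * (mulOp χ * G)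
        + (mulOp χ * Gw - G * mulOp χ) * (Gw * mulOp χ - mulOp χ * G)
        - G * (mulOp (fun x => 1 - χ x * χ x) * G)) * mulOp cR := by
    rw [core_sq_sub_sq G Gw (mulOp χ) hcLχ' hχcR', hone]
  rw [hop]
  refine hasMajorant_mono blk hcut (fun a b => le_of_eq ?_)
  simp only [Ctot]
  ring

/-- **The printed factor**: if both cuts live on blocks of depth `≥ M₀` (□ and supp h_□ are `M` big blocks away
from □̃ᶜ, p. 238), the 𝔅-majorant of `cL·(Gw² − G²)·cR` is `Λ·P(y)²·Ctot·e^{−((δ−κ)/3)M₀}·e^{−((δ−κ)/6)d(y,y′)}`: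
*"an estimate has the factor e^{−δ₀M}"* times the standard exponential factor, at the certificate's rates.
[cite: Balaban1984PropagatorsII, p.238 before (2.85)] -/
theorem line3_deep_majorant (blk : X → g.Site) (hρ : IsPseudoDist g.dist) {β : g.Site → ℝ}
    (hβ : IsDepth g.dist β) {K : ℝ → ℝ} (hK : ∀ a, 0 < a → 0 ≤ K a)
    (hPr : Profile g.dist (fun a : g.Site => a) K) (N : Finset g.Site) (hN : ∀ a ∈ N, β a = 0)
    {P : g.Site → ℝ} (hP0 : ∀ a, 0 ≤ P a) {κ Λ : ℝ} (hκ : 0 ≤ κ) (hΛ : 0 ≤ Λ)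
    (hPΛ : ∀ a c, Real.exp (-(κ * g.dist a c)) * P c ≤ Λ * P a)
    {δ B₁ θ : ℝ} (hκδ : κ < δ) (hB₁ : 0 ≤ B₁) (hθ : 0 ≤ θ)
    {G D Gw : Module.End ℝ (X → ℝ)} {χ cL cR : X → ℝ}
    (hχ1 : ∀ x, |χ x| ≤ 1) (hcL1 : ∀ x, |cL x| ≤ 1) (hcR1 : ∀ x, |cR x| ≤ 1)
    (hcLχ : ∀ x, cL x * χ x = cL x) (hcRχ : ∀ x, χ x * cR x = cR x)
    (hχN : ∀ x, blk x ∉ N → χ x = 1)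
    (hGD : G * D = 1) (hDG : D * G = 1)
    (hχGw : mulOp χ * D * Gw = mulOp χ) (hGwχ : Gw * D * mulOp χ = mulOp χ)
    (hG : HasMajorant blk G (fun a b => B₁ * P a * Real.exp (-(δ * g.dist a b))))
    (hGw : HasMajorant blk Gw (fun a b => B₁ * P a * Real.exp (-(δ * g.dist a b))))
    (hKGw : HasMajorant blk ((mulOp χ * D - D * mulOp χ) * Gw)
      (fun a b => (if a ∈ N then θ else 0) * Real.exp (-(δ * g.dist a b))))
    (hKG : HasMajorant blk ((mulOp χ * D - D * mulOp χ) * G)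
      (fun a b => (if a ∈ N then θ else 0) * Real.exp (-(δ * g.dist a b))))
    {M₀ : ℝ} (hLdeep : ∀ x, cL x ≠ 0 → M₀ ≤ β (blk x)) (hRdeep : ∀ x, cR x ≠ 0 → M₀ ≤ β (blk x)) :
    HasMajorant blk (mulOp cL * (Gw * Gw - G * G) * mulOp cR)
      (fun a b => Λ * P a ^ 2 * Ctot K B₁ θ (δ - κ) * Real.exp (-((δ - κ) / 3 * M₀)) *
        Real.exp (-((δ - κ) / 3 / 2 * g.dist a b))) := by
  have hmain := line3_core_majorant blk hρ hβ hK hPr N hN hP0 hκ hΛ hPΛ hκδ hB₁ hθ hχ1 hcL1 hcR1 hcLχ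
    hcRχ hχN hGD hDG hχGw hGwχ hG hGw hKGw hKG
  have hδ₁ : 0 < δ - κ := by linarith
  have hC : 0 ≤ Ctot K B₁ θ (δ - κ) := Ctot_nonneg hK hB₁ hθ hδ₁
  intro y' μ B hμ x
  have hRHS : 0 ≤ Λ * P (blk x) ^ 2 * Ctot K B₁ θ (δ - κ) * Real.exp (-((δ - κ) / 3 * M₀)) *
      Real.exp (-((δ - κ) / 3 / 2 * g.dist (blk x) y')) * B := by
    have := hμ.nonneg
    positivity
  have happ : (mulOp cL * (Gw * Gw - G * G) * mulOp cR) μ x =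
      cL x * ((Gw * Gw - G * G) (mulOp cR μ)) x := by
    simp only [Module.End.mul_apply, mulOp_apply]
  by_cases hx : cL x = 0
  · rw [happ, hx, zero_mul, abs_zero]
    exact hRHS
  by_cases hy : ∃ x', blk x' = y' ∧ cR x' ≠ 0
  · obtain ⟨x', hx'b, hx'c⟩ := hy
    have ha : M₀ ≤ β (blk x) := hLdeep x hx
    have hb : M₀ ≤ β y' := by rw [← hx'b]; exact hRdeep x' hx'c
    refine (hmain y' μ B hμ x).trans (mul_le_mul_of_nonneg_right ?_ hμ.nonneg)
    have hexp : Real.exp (-((δ - κ) / 3 / 2 * (g.dist (blk x) y' + β (blk x) + β y'))) ≤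
        Real.exp (-((δ - κ) / 3 * M₀)) * Real.exp (-((δ - κ) / 3 / 2 * g.dist (blk x) y')) := by
      rw [← Real.exp_add]
      exact Real.exp_le_exp.2 (by nlinarith)
    calc Λ * P (blk x) ^ 2 * Ctot K B₁ θ (δ - κ) *
          Real.exp (-((δ - κ) / 3 / 2 * (g.dist (blk x) y' + β (blk x) + β y')))
        ≤ Λ * P (blk x) ^ 2 * Ctot K B₁ θ (δ - κ) *
          (Real.exp (-((δ - κ) / 3 * M₀)) * Real.exp (-((δ - κ) / 3 / 2 * g.dist (blk x) y'))) :=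
          mul_le_mul_of_nonneg_left hexp (by positivity)
      _ = Λ * P (blk x) ^ 2 * Ctot K B₁ θ (δ - κ) * Real.exp (-((δ - κ) / 3 * M₀)) *
          Real.exp (-((δ - κ) / 3 / 2 * g.dist (blk x) y')) := by ring
  · have hzero : mulOp cR μ = 0 := by
      funext x'
      rw [mulOp_apply, Pi.zero_apply]
      by_cases hb : blk x' = y'
      · have : cR x' = 0 := by
          by_contra hne
          exact hy ⟨x', hb, hne⟩
        rw [this, zero_mul]
      · rw [hμ.off x' hb, mul_zero]
    rw [happ, hzero, map_zero, Pi.zero_apply, mul_zero, abs_zero]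
    exact hRHS

end Line3

/-! ## §4  Instances of the bookkeeping hypotheses of §3: (2.60) ⇒ the scale transfer, (2.61) ⇒ a profile,
the depth to the zone; the assembled theorem from the displayed inequalities of Lemma 2.1 -/

section Transfer

variable {g : B6.Geometry}

/-- The located size condition in logarithmic form: `γ·ln L ≤ a` and `L ≥ 1` give `L^γ·e^{−a} ≤ 1` (for
`a = α′δ₀RM`: RM ≥ γ ln L/(α′δ₀), the shape of (2.59)/(2.88)). [folklore] -/
theorem pow_mul_exp_neg_le_one (hL : 1 ≤ g.L) (γ : ℕ) {a : ℝ} (h : (γ : ℝ) * Real.log g.L ≤ a) :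
    g.L ^ γ * Real.exp (-a) ≤ 1 := by
  have hL0 : 0 < g.L := lt_of_lt_of_le zero_lt_one hL
  have hpow : g.L ^ γ = Real.exp ((γ : ℝ) * Real.log g.L) := by
    rw [Real.exp_nat_mul, Real.exp_log hL0]
  rw [hpow, ← Real.exp_add]
  calc Real.exp ((γ : ℝ) * Real.log g.L + -a) ≤ Real.exp 0 := Real.exp_le_exp.2 (by linarith)
    _ = 1 := Real.exp_zero

/-- **(2.60) ⇒ THE SCALE TRANSFER** for the weights L^{γj}, y ∈ Λ_j: if (2.60) holds at the exponent α′
(`B6RandomWalk.Ineq260 g δ₀ α'`, the printed *"e^{−αδ₀d(y,y′)} ≤ e^{−αδ₀RM max{|j−j′|−1,0}}"*), α′δ₀ ≥ 0, RM ≥ 0,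
L ≥ 1 and the located size condition `L^γ·e^{−α′δ₀RM} ≤ 1` holds, then
`e^{−α′δ₀d(y,y″)}·L^{γj″} ≤ L^γ·L^{γj}` (y ∈ Λ_j, y″ ∈ Λ_{j″}): each of the max{|j−j″|−1,0} intermediate layers
costs RM in d and a factor L^γ in the weight; the one free layer is the factor L^γ.  (The B9-geometry twin with
abstract layer count is `…B9Ineq347.scaleTransfer_of_260`.) [cite: Balaban1984PropagatorsII, (2.60) p.234] -/
theorem transfer_pow_of_ineq260 {δ₀ α' : ℝ} (h260 : B6RandomWalk.Ineq260 g δ₀ α') (hα' : 0 ≤ α' * δ₀)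
    (hRM : 0 ≤ g.R * g.M) (hL : 1 ≤ g.L) (γ : ℕ)
    (hsize : g.L ^ γ * Real.exp (-(α' * δ₀ * (g.R * g.M))) ≤ 1) (y y'' : g.Site) :
    Real.exp (-(α' * δ₀ * g.dist y y'')) * g.L ^ (γ * g.scale y'') ≤ g.L ^ γ * g.L ^ (γ * g.scale y) := by
  have hL0 : 0 ≤ g.L := le_trans zero_le_one hL
  have h1 := h260 y y''
  have hsplit : g.L ^ γ * g.L ^ (γ * g.scale y) = g.L ^ (γ * (g.scale y + 1)) := by
    rw [mul_add, mul_one, pow_add, mul_comm]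
  rcases Nat.lt_or_ge (g.scale y + 1) (g.scale y'') with hlt | hle
  swap
  · -- j″ ≤ j + 1: the exponential is ≤ 1, the weight is ≤ L^{γ(j+1)}
    have hm : 0 ≤ max (|(g.scale y : ℝ) - g.scale y''| - 1) 0 := le_max_right _ _
    have hexp : Real.exp (-(α' * δ₀ * g.dist y y'')) ≤ 1 := by
      refine le_trans h1 ?_
      have h0 : 0 ≤ α' * δ₀ * g.R * g.M * max (|(g.scale y : ℝ) - g.scale y''| - 1) 0 := by
        have := mul_nonneg (mul_nonneg hα' hRM) hm
        calc (0 : ℝ) ≤ α' * δ₀ * (g.R * g.M) * max (|(g.scale y : ℝ) - g.scale y''| - 1) 0 := this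
          _ = _ := by ring
      calc Real.exp (-(α' * δ₀ * g.R * g.M * max (|(g.scale y : ℝ) - g.scale y''| - 1) 0))
          ≤ Real.exp 0 := Real.exp_le_exp.2 (by linarith)
        _ = 1 := Real.exp_zero
    have hw : g.L ^ (γ * g.scale y'') ≤ g.L ^ (γ * (g.scale y + 1)) :=
      pow_le_pow_right₀ hL (Nat.mul_le_mul_left γ hle)
    calc Real.exp (-(α' * δ₀ * g.dist y y'')) * g.L ^ (γ * g.scale y'')
        ≤ 1 * g.L ^ (γ * (g.scale y + 1)) :=
          mul_le_mul hexp hw (pow_nonneg hL0 _) zero_le_one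
      _ = g.L ^ γ * g.L ^ (γ * g.scale y) := by rw [one_mul, hsplit]
  · -- j″ = j + 1 + n, n ≥ 1: (2.60) gives q^n, the weight gives (L^γ)^n·L^{γ(j+1)}, and (L^γ q)^n ≤ 1
    obtain ⟨n, hn⟩ : ∃ n : ℕ, g.scale y'' = g.scale y + 1 + n :=
      ⟨g.scale y'' - (g.scale y + 1), by omega⟩
    have hm : max (|(g.scale y : ℝ) - g.scale y''| - 1) 0 = n := by
      rw [hn]; push_cast
      rw [show (g.scale y : ℝ) - (g.scale y + 1 + n) = -((n : ℝ) + 1) by ring, abs_neg,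
        abs_of_nonneg (by positivity)]
      simp
    set q : ℝ := Real.exp (-(α' * δ₀ * (g.R * g.M))) with hq
    have hq0 : 0 ≤ q := Real.exp_nonneg _
    have hexp : Real.exp (-(α' * δ₀ * g.dist y y'')) ≤ q ^ n := by
      refine le_trans h1 (le_of_eq ?_)
      rw [hm, hq, ← Real.exp_nat_mul]
      congr 1; ring
    have hw : g.L ^ (γ * g.scale y'') = (g.L ^ γ) ^ n * g.L ^ (γ * (g.scale y + 1)) := by
      rw [hn, show γ * (g.scale y + 1 + n) = γ * n + γ * (g.scale y + 1) by ring, pow_add, pow_mul]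
    have hsmall : (g.L ^ γ * q) ^ n ≤ 1 := pow_le_one₀ (mul_nonneg (pow_nonneg hL0 _) hq0) hsize
    have hW0 : 0 ≤ g.L ^ (γ * (g.scale y + 1)) := pow_nonneg hL0 _
    calc Real.exp (-(α' * δ₀ * g.dist y y'')) * g.L ^ (γ * g.scale y'')
        ≤ q ^ n * g.L ^ (γ * g.scale y'') :=
          mul_le_mul_of_nonneg_right hexp (pow_nonneg hL0 _)
      _ = (g.L ^ γ * q) ^ n * g.L ^ (γ * (g.scale y + 1)) := by rw [hw, mul_pow]; ring
      _ ≤ 1 * g.L ^ (γ * (g.scale y + 1)) := mul_le_mul_of_nonneg_right hsmall hW0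
      _ = g.L ^ γ * g.L ^ (γ * g.scale y) := by rw [one_mul, hsplit]

/-- (2.60) ⇒ the scale transfer for the weights `(Lʲη)^γ = g.len y ^ γ` (η ≥ 0):
`e^{−α′δ₀d(y,y″)}(L^{j″}η)^γ ≤ L^γ(Lʲη)^γ`. [cite: Balaban1984PropagatorsII, (2.60) p.234] -/
theorem transfer_len_pow_of_ineq260 {δ₀ α' : ℝ} (h260 : B6RandomWalk.Ineq260 g δ₀ α') (hα' : 0 ≤ α' * δ₀)
    (hRM : 0 ≤ g.R * g.M) (hL : 1 ≤ g.L) (hη : 0 ≤ g.eta) (γ : ℕ)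
    (hsize : g.L ^ γ * Real.exp (-(α' * δ₀ * (g.R * g.M))) ≤ 1) (y y'' : g.Site) :
    Real.exp (-(α' * δ₀ * g.dist y y'')) * g.len y'' ^ γ ≤ g.L ^ γ * g.len y ^ γ := by
  have h := transfer_pow_of_ineq260 h260 hα' hRM hL γ hsize y y''
  have hηγ : 0 ≤ g.eta ^ γ := pow_nonneg hη _
  have e1 : g.len y'' ^ γ = g.L ^ (γ * g.scale y'') * g.eta ^ γ := by
    unfold B6.Geometry.len; rw [mul_pow, ← pow_mul, mul_comm (g.scale y'') γ]
  have e2 : g.len y ^ γ = g.L ^ (γ * g.scale y) * g.eta ^ γ := by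
    unfold B6.Geometry.len; rw [mul_pow, ← pow_mul, mul_comm (g.scale y) γ]
  rw [e1, e2]
  calc Real.exp (-(α' * δ₀ * g.dist y y'')) * (g.L ^ (γ * g.scale y'') * g.eta ^ γ)
      = Real.exp (-(α' * δ₀ * g.dist y y'')) * g.L ^ (γ * g.scale y'') * g.eta ^ γ := by ring
    _ ≤ g.L ^ γ * g.L ^ (γ * g.scale y) * g.eta ^ γ := mul_le_mul_of_nonneg_right h hηγ
    _ = g.L ^ γ * (g.L ^ (γ * g.scale y) * g.eta ^ γ) := by ring

/-- **(2.60) ⇒ the scale-transfer hypothesis `hPΛ` of `line3_core_majorant`** for the weight of (2.67)₁,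
`P(y) = (Lʲη)²`, with `κ = α′δ₀`, `Λ = L²` (no sign condition on η): `e^{−α′δ₀d(y,y″)}(L^{j″}η)² ≤ L²(Lʲη)²`
under `L²e^{−α′δ₀RM} ≤ 1`, i.e. RM ≥ 2 ln L/(α′δ₀). [cite: Balaban1984PropagatorsII, (2.60) p.234] -/
theorem transfer_len_sq_of_ineq260 {δ₀ α' : ℝ} (h260 : B6RandomWalk.Ineq260 g δ₀ α') (hα' : 0 ≤ α' * δ₀)
    (hRM : 0 ≤ g.R * g.M) (hL : 1 ≤ g.L) (hsize : g.L ^ 2 * Real.exp (-(α' * δ₀ * (g.R * g.M))) ≤ 1) :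
    ∀ y y'' : g.Site, Real.exp (-(α' * δ₀ * g.dist y y'')) * g.len y'' ^ 2 ≤ g.L ^ 2 * g.len y ^ 2 := by
  intro y y''
  have h := transfer_pow_of_ineq260 h260 hα' hRM hL 2 hsize y y''
  have hη : 0 ≤ g.eta ^ 2 := sq_nonneg _
  have e1 : g.len y'' ^ 2 = g.L ^ (2 * g.scale y'') * g.eta ^ 2 := by
    unfold B6.Geometry.len; rw [mul_pow, ← pow_mul, mul_comm (g.scale y'') 2]
  have e2 : g.len y ^ 2 = g.L ^ (2 * g.scale y) * g.eta ^ 2 := by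
    unfold B6.Geometry.len; rw [mul_pow, ← pow_mul, mul_comm (g.scale y) 2]
  rw [e1, e2]
  calc Real.exp (-(α' * δ₀ * g.dist y y'')) * (g.L ^ (2 * g.scale y'') * g.eta ^ 2)
      = Real.exp (-(α' * δ₀ * g.dist y y'')) * g.L ^ (2 * g.scale y'') * g.eta ^ 2 := by ring
    _ ≤ g.L ^ 2 * g.L ^ (2 * g.scale y) * g.eta ^ 2 := mul_le_mul_of_nonneg_right h hη
    _ = g.L ^ 2 * (g.L ^ (2 * g.scale y) * g.eta ^ 2) := by ring

end Transfer

section ProfileOf261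

variable {g : B6.Geometry}

/-- The profile function manufactured from (2.61) at ONE exponent α: at rates `a ≥ αδ₀` the bound is the printed
`c₁(α)` (clipped below at 0), at smaller rates only the trivial `|𝔅|` — uniformity is claimed exactly where (2.61)
gives it. OURS (typing). [cite: Balaban1984PropagatorsII, (2.61) p.234] -/
noncomputable def profileK (g : B6.Geometry) (d : ℕ) (δ₀ α : ℝ) : ℝ → ℝ :=
  fun a => if α * δ₀ ≤ a then max (B6.c1 d δ₀ α) 0 else (Fintype.card g.Site : ℝ)

/-- `profileK` is non-negative. [folklore] -/
theorem profileK_nonneg (d : ℕ) (δ₀ α a : ℝ) : 0 ≤ profileK g d δ₀ α a := by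
  unfold profileK
  split_ifs
  · exact le_max_right _ _
  · exact Nat.cast_nonneg _

/-- At rates `a ≥ αδ₀` the profile is the printed constant: `profileK a = max{c₁(α), 0}`. [folklore] -/
theorem profileK_of_le {d : ℕ} {δ₀ α a : ℝ} (h : α * δ₀ ≤ a) : profileK g d δ₀ α a = max (B6.c1 d δ₀ α) 0 := by
  unfold profileK; rw [if_pos h]

/-- **(2.61) ⇒ the profile hypothesis `hPr` of `line3_core_majorant`**: if *"sup_{y∈𝔅} Σ_{y′∈𝔅} e^{−αδ₀d(y,y′)} ≤
c₁(α)"* (`B6RandomWalk.Ineq261 d g δ₀ α`) and d ≥ 0, then `Σ_{y′} e^{−a·d(y,y′)} ≤ profileK a` for every a > 0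
(monotonicity in the rate for a ≥ αδ₀; the count of 𝔅 below). [cite: Balaban1984PropagatorsII, (2.61) p.234] -/
theorem profile_of_ineq261 {d : ℕ} {δ₀ α : ℝ} (h261 : B6RandomWalk.Ineq261 d g δ₀ α)
    (hd : ∀ y y' : g.Site, 0 ≤ g.dist y y') :
    Profile g.dist (fun a : g.Site => a) (profileK g d δ₀ α) := by
  intro a ha s
  unfold profileK
  split_ifs with h
  · calc ∑ j, Real.exp (-(a * g.dist s j)) ≤ ∑ j, Real.exp (-(α * δ₀ * g.dist s j)) :=
          Finset.sum_le_sum fun j _ => Real.exp_le_exp.2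
            (neg_le_neg (mul_le_mul_of_nonneg_right h (hd s j)))
      _ ≤ B6.c1 d δ₀ α := h261 s
      _ ≤ max (B6.c1 d δ₀ α) 0 := le_max_left _ _
  · calc ∑ j, Real.exp (-(a * g.dist s j)) ≤ ∑ _j : g.Site, (1 : ℝ) :=
          Finset.sum_le_sum fun j _ => by
            calc Real.exp (-(a * g.dist s j)) ≤ Real.exp 0 :=
                  Real.exp_le_exp.2 (neg_nonpos.2 (mul_nonneg ha.le (hd s j)))
              _ = 1 := Real.exp_zero
      _ = (Fintype.card g.Site : ℝ) := by simp

end ProfileOf261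

section ZoneDepth

variable {S : Type*}

/-- THE DEPTH TO THE ZONE: `zoneDepth ρ N s = min_{n ∈ N} ρ(s, n)` for a non-empty finite zone N — the printed
dist(·, Ωᶜ)-type function of (1.12) [3] with Ωᶜ ↦ the zone where the two operators differ. OURS (typing). [folklore] -/
noncomputable def zoneDepth (ρ : S → S → ℝ) (N : Finset S) (hN : N.Nonempty) (s : S) : ℝ :=
  N.inf' hN (fun n => ρ s n)

/-- the depth is at most the distance to any zone point [folklore] -/
theorem zoneDepth_le (ρ : S → S → ℝ) {N : Finset S} (hN : N.Nonempty) (s : S) {n : S} (hn : n ∈ N) :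
    zoneDepth ρ N hN s ≤ ρ s n :=
  Finset.inf'_le (fun n => ρ s n) hn

/-- a point at distance ≥ M₀ from every zone point has depth ≥ M₀ [folklore] -/
theorem le_zoneDepth (ρ : S → S → ℝ) {N : Finset S} (hN : N.Nonempty) {s : S} {M₀ : ℝ}
    (h : ∀ n ∈ N, M₀ ≤ ρ s n) : M₀ ≤ zoneDepth ρ N hN s :=
  Finset.le_inf' hN _ h

/-- **the depth to the zone is a depth** (`IsDepth`: non-negative and ρ-Lipschitz) for a pseudo-distance ρ.
[folklore] -/
theorem isDepth_zoneDepth {ρ : S → S → ℝ} (hρ : IsPseudoDist ρ) (N : Finset S) (hN : N.Nonempty) :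
    IsDepth ρ (zoneDepth ρ N hN) where
  nonneg s := Finset.le_inf' hN _ fun n _ => hρ.nonneg s n
  lip s t := by
    obtain ⟨n, hn, he⟩ := Finset.exists_mem_eq_inf' hN (fun n => ρ t n)
    calc zoneDepth ρ N hN s ≤ ρ s n := zoneDepth_le ρ hN s hn
      _ ≤ ρ s t + ρ t n := hρ.triangle s t n
      _ = ρ s t + zoneDepth ρ N hN t := by unfold zoneDepth; rw [he]

/-- the depth vanishes on the zone [folklore] -/
theorem zoneDepth_eq_zero {ρ : S → S → ℝ} (hρ : IsPseudoDist ρ) {N : Finset S} (hN : N.Nonempty) {a : S}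
    (ha : a ∈ N) : zoneDepth ρ N hN a = 0 :=
  le_antisymm ((zoneDepth_le ρ hN a ha).trans_eq (hρ.zero a)) ((isDepth_zoneDepth hρ N hN).nonneg a)

end ZoneDepth

section Line3Lemma21

variable {g : B6.Geometry} [DecidableEq g.Site] {X : Type}

/-- **(2.82), LINE 3 — the deep evaluation with the bookkeeping hypotheses discharged from the DISPLAYED
inequalities of Lemma 2.1.**  Same operators, cuts and majorant hypotheses as `line3_deep_majorant`, with the
weight of (2.67)₁ `P(y) = (Lʲη)²`; the scale transfer is (2.60) at an exponent α′ (`B6RandomWalk.Ineq260 g δ₀ α'`,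
α′δ₀ ≥ 0, RM ≥ 0, L ≥ 1, located size condition `L²e^{−α′δ₀RM} ≤ 1`), the profile is (2.61) at an exponent α
(`B6RandomWalk.Ineq261 d g δ₀ α`; `profileK`), the depth is the distance to the zone N ≠ ∅ (`zoneDepth`), and the cuts
live on blocks at distance ≥ M₀ from every block of N.  Conclusion: `cL·(Gw·Gw − G·G)·cR` has the 𝔅-majorant
`L²·(Lʲη)⁴·Ctot (profileK) B₁ θ (δ − α′δ₀)·e^{−((δ−α′δ₀)/3)M₀}·e^{−((δ−α′δ₀)/6)d(y,y′)}` — *"an estimate has the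
factor e^{−δ₀M} because of the usual estimate of the type (1.12) [3] connected with a change of a domain"* at the
certificate's rate, with the `(Lʲη)⁴` of G′².  Remaining hypotheses: the (2.67)₁-type majorants of G′ and G′(□̃),
the zone majorants of the commutator products, the algebraic cut relations, (2.54) as `IsPseudoDist`.
[cite: Balaban1984PropagatorsII, p.238 before (2.85) + (2.82) line 3 p.237 + (2.60)–(2.61) p.234] -/
theorem line3_deep_majorant_lemma21 (blk : X → g.Site) (hρ : IsPseudoDist g.dist) {d : ℕ} {δ₀ α α' : ℝ}
    (h260 : B6RandomWalk.Ineq260 g δ₀ α') (h261 : B6RandomWalk.Ineq261 d g δ₀ α)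
    (hα' : 0 ≤ α' * δ₀) (hRM : 0 ≤ g.R * g.M) (hL : 1 ≤ g.L)
    (hsize : g.L ^ 2 * Real.exp (-(α' * δ₀ * (g.R * g.M))) ≤ 1)
    (N : Finset g.Site) (hN : N.Nonempty)
    {δ B₁ θ : ℝ} (hκδ : α' * δ₀ < δ) (hB₁ : 0 ≤ B₁) (hθ : 0 ≤ θ)
    {G D Gw : Module.End ℝ (X → ℝ)} {χ cL cR : X → ℝ}
    (hχ1 : ∀ x, |χ x| ≤ 1) (hcL1 : ∀ x, |cL x| ≤ 1) (hcR1 : ∀ x, |cR x| ≤ 1)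
    (hcLχ : ∀ x, cL x * χ x = cL x) (hcRχ : ∀ x, χ x * cR x = cR x)
    (hχN : ∀ x, blk x ∉ N → χ x = 1)
    (hGD : G * D = 1) (hDG : D * G = 1)
    (hχGw : mulOp χ * D * Gw = mulOp χ) (hGwχ : Gw * D * mulOp χ = mulOp χ)
    (hG : HasMajorant blk G (fun a b => B₁ * g.len a ^ 2 * Real.exp (-(δ * g.dist a b))))
    (hGw : HasMajorant blk Gw (fun a b => B₁ * g.len a ^ 2 * Real.exp (-(δ * g.dist a b))))
    (hKGw : HasMajorant blk ((mulOp χ * D - D * mulOp χ) * Gw)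
      (fun a b => (if a ∈ N then θ else 0) * Real.exp (-(δ * g.dist a b))))
    (hKG : HasMajorant blk ((mulOp χ * D - D * mulOp χ) * G)
      (fun a b => (if a ∈ N then θ else 0) * Real.exp (-(δ * g.dist a b))))
    {M₀ : ℝ} (hLdeep : ∀ x, cL x ≠ 0 → ∀ n ∈ N, M₀ ≤ g.dist (blk x) n)
    (hRdeep : ∀ x, cR x ≠ 0 → ∀ n ∈ N, M₀ ≤ g.dist (blk x) n) :
    HasMajorant blk (mulOp cL * (Gw * Gw - G * G) * mulOp cR)
      (fun a b => g.L ^ 2 * (g.len a ^ 2) ^ 2 * Ctot (profileK g d δ₀ α) B₁ θ (δ - α' * δ₀) *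
        Real.exp (-((δ - α' * δ₀) / 3 * M₀)) * Real.exp (-((δ - α' * δ₀) / 3 / 2 * g.dist a b))) :=
  line3_deep_majorant blk hρ (isDepth_zoneDepth hρ N hN) (K := profileK g d δ₀ α)
    (fun a _ => profileK_nonneg d δ₀ α a) (profile_of_ineq261 h261 hρ.nonneg) N
    (fun _ ha => zoneDepth_eq_zero hρ hN ha) (P := fun a => g.len a ^ 2) (fun a => sq_nonneg (g.len a)) hα'
    (pow_nonneg (le_trans zero_le_one hL) 2) (transfer_len_sq_of_ineq260 h260 hα' hRM hL hsize) hκδ hB₁ hθ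
    hχ1 hcL1 hcR1 hcLχ hcRχ hχN hGD hDG hχGw hGwχ hG hGw hKGw hKG
    (fun x hx => le_zoneDepth g.dist hN (hLdeep x hx)) (fun x hx => le_zoneDepth g.dist hN (hRdeep x hx))

end Line3Lemma21

end Literature.MathematicalPhysics.QuantumFieldTheory.Balaban1983to89.B6DomainMajorant
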